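import Summits.BirchSwinnertonDyer.BirchSwinnertonDyer.Theorems.ManinLocalTwoThreeShimuraQuotientRational
import Summits.BirchSwinnertonDyer.BirchSwinnertonDyer.Theorems.ManinLocalTwoThreeShimuraIndexMuThreeLine
import Summits.BirchSwinnertonDyer.BirchSwinnertonDyer.Theorems.ManinLocalTwoThreeNotTrivialEisensteinOdd
import HarnessLib

/-!
# The index-`9` exclusion `Λ₁(f) ≠ 3Λ₀(f)` is a THEOREM (modulo the printed F★): an optimal `X₁(N)`-datum with
# `Λ₁(f) = 3Λ₀(f)` would put all nine `3`-torsion points of Stevens' curve in `W₁(ℚ)`, and then `ζ₃ ∈ ℚ`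

Summit `BirchSwinnertonDyer`, route `ManinLocalTwoThree` (cell bsd-f2-manin), crux C3 `ManinPrimeToThreeAtNine`
(stmt-BirchSwinnertonDyer-22968).  The LEAD's reduction `maninPrimeToThreeAtNine_of_stevensConjectures` (p716357,
`…ManinOfStevensConjectures`) derives C3 from F-need `hex`, Stevens' Conjectures I and II, and ONE index exclusion `hne9`: «no
lattice-optimal `X₀(N)`-datum at `9 ∣ N` has `Λ₁(f) = 3Λ₀(f)`» — known there only at `N = 9p`, `p ≡ 2 (mod 3)`.  THIS FILE proves the
exclusion at EVERY level (indeed without `9 ∣ N` and without lattice-optimality of the `X₀`-datum), modulo the printed named fact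
F★ `optimalGamma1Parametrization_cusp_rational` (Conrad–Edixhoven–Stein 2003, §6.1–6.2: the optimal `X₁(N)`-parametrisation maps the
cusps over `∞` to rational points) — the `p = 3` twin of the LEAD's `exists_two_roots_of_index_four` (p1 g10), where the `p = 2` twin
only yields full rational `2`-torsion (which exists), but full rational `3`-torsion does not:

* §1 `forall_smul_eq_of_nine_torsion_points`, `false_of_nine_torsion_points` — nine pairwise distinct RATIONAL points killed by `3`
  fill `W[3]` (`#W[3] = 9`, `natCard_geomTorsion`; base change `E(ℚ) → E(ℚ̄)` is injective and lands in the `Γ_ℚ`-fixed points,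
  `fixedPoints_eq_range_map_holds`), so `Γ_ℚ` fixes `W[3]` pointwise, hence fixes a primitive cube root of unity
  (`exists_isPrimitiveRoot_fixed`, the Weil pairing), which is then rational (`exists_ratCast_algebraMap_eq_of_forall_algEquiv_eq`) —
  but `q³ = 1` forces `q = 1` in `ℚ`.
* §2 **`periodLatticeGamma1_ne_three_mul_periodLattice`** — for an OPTIMAL `X₁(N)`-datum `D₁` of an elliptic `W₁/ℚ`:
  `Λ₁(f) ≠ 3Λ₀(f)`.  If `Λ₁(f) = 3Λ₀(f)` then every third-period `z` of `Λ_{E₁} = c₁Λ₁(f)` is `c₁·w` with `w ∈ Λ₀(f)`, so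
  `u₁(z)` is a rational point (F★, the LEAD's `exists_point_eq_uniformize_of_mem_periodLattice`); the nine third-periods
  `(iω₁ + jω₂)/3` give nine distinct rational points killed by `3` (`PeriodPair.mul_ω₁_add_mul_ω₂_mem_lattice`); §1.
  **`periodLatticeGamma1_ne_three_mul_of_cusp_rational`** — the LEAD's binder `hne9` verbatim, from `hex` ∧ F★
  (`Gamma1ParametrizationData.f_eq_of_isIsogenous`).
* (Sequel `…ShimuraIndexNeNineStevens.lean`, in the route cone: C3 `ManinPrimeToThreeAtNine` ⟸ `hex` ∧ F★ ∧ Stevens I ∧ Stevens II —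
  the LEAD's `maninPrimeToThreeAtNine_of_stevensConjectures` with the index exclusion discharged.)

HONEST FRAMING: conditional reductions; F★, `hex`, Stevens' Conjectures I/II are OPEN named facts / laws; C3, Manin's conjecture and BSD
are NOT proved.  No definitions, no sorry; axioms standard.  References: G. Stevens, Invent. Math. 98 (1989) §2 and Conjectures I–III;
B. Conrad, B. Edixhoven, W. Stein, Doc. Math. 8 (2003) §6; J. H. Silverman, *AEC* III.8 (Weil pairing), VIII.1.
-/

set_option autoImplicit false
set_option linter.dupNamespace false

noncomputable section

open scoped Classical

open NumberField IsDedekindDomain Field WeierstrassCurve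
  Literature.NumberTheory.EllipticCurves Literature.NumberTheory.EllipticCurves.ModularForms
  Literature.NumberTheory.GaloisRepresentations
  Summit.BirchSwinnertonDyer.Rank1Residual.ManinAdditive
  Summit.BirchSwinnertonDyer.Rank1Residual.ManinAdditive.KatoCurve

namespace Summit.BirchSwinnertonDyer.BirchSwinnertonDyer.Theorems.ManinLocalTwoThree

/-! ### §1  Nine rational `3`-torsion points are impossible -/

section NinePoints

variable (W : WeierstrassCurve ℚ) [W.IsElliptic]

/-- **Nine distinct rational points killed by `3` fill `W[3]`, so `Γ_ℚ` acts trivially on `W[3]`.**  (`#W[3] = 9`; base change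
`E(ℚ) → E(ℚ̄)` is an injective homomorphism into the `Γ_ℚ`-fixed points.) [cite: SilvermanAEC2009, Cor. III.6.4(b) and VIII.§1] -/
theorem forall_smul_eq_of_nine_torsion_points (P : Fin 3 × Fin 3 → (W.baseChange ℚ).toAffine.Point)
    (hinj : Function.Injective P) (h3 : ∀ i, (3 : ℤ) • P i = 0) :
    ∀ (τ : absoluteGaloisGroup ℚ) (T : W.geomTorsion ((3 : ℕ) : ℤ)), τ • T = T := by
  -- base change to `ℚ̄`
  set bc : (W.baseChange ℚ).toAffine.Point →+ W.geomPoints :=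
    Affine.Point.baseChange (W' := W) ℚ (AlgebraicClosure ℚ) with hbc
  have hbc_inj : Function.Injective bc := Affine.Point.map_injective _
  have hmem : ∀ i, bc (P i) ∈ W.geomTorsion ((3 : ℕ) : ℤ) := by
    intro i
    simp only [Submodule.mem_toAddSubgroup, Submodule.mem_torsionBy_iff]
    show ((3 : ℕ) : ℤ) • bc (P i) = 0
    rw [← map_zsmul, Nat.cast_ofNat, h3 i, map_zero]
  set f : Fin 3 × Fin 3 → W.geomTorsion ((3 : ℕ) : ℤ) := fun i ↦ ⟨bc (P i), hmem i⟩ with hf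
  have hfinj : Function.Injective f := by
    intro i j hij
    apply hinj
    apply hbc_inj
    simpa [hf] using congrArg Subtype.val hij
  -- `#W[3] = 9`, so `f` is onto
  have hcard : Nat.card (W.geomTorsion ((3 : ℕ) : ℤ)) = 9 := by
    rw [natCard_geomTorsion W ((3 : ℕ) : ℤ) (by norm_num)]; rfl
  haveI : Finite (W.geomTorsion ((3 : ℕ) : ℤ)) := Nat.finite_of_card_ne_zero (by rw [hcard]; norm_num)
  haveI : Fintype (W.geomTorsion ((3 : ℕ) : ℤ)) := Fintype.ofFinite _
  have hsurj : Function.Surjective f := by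
    have hbij : Function.Bijective f := by
      rw [Fintype.bijective_iff_injective_and_card]
      refine ⟨hfinj, ?_⟩
      rw [Fintype.card_prod, Fintype.card_fin, ← Nat.card_eq_fintype_card (α := W.geomTorsion ((3 : ℕ) : ℤ)), hcard]
    exact hbij.2
  -- base-changed rational points are `Γ_ℚ`-fixed
  haveI : PerfectField ℚ := PerfectField.ofCharZero
  have hfp : MulAction.fixedPoints (absoluteGaloisGroup ℚ) W.geomPoints =
      Set.range (fun Q : (W.baseChange ℚ).toAffine.Point ↦
        (Affine.Point.baseChange ℚ (AlgebraicClosure ℚ) Q : W.geomPoints)) :=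
    fixedPoints_eq_range_map_holds W
  have hfix : ∀ (τ : absoluteGaloisGroup ℚ) (i : Fin 3 × Fin 3), τ • bc (P i) = bc (P i) := by
    intro τ i
    have hmemfix : bc (P i) ∈ MulAction.fixedPoints (absoluteGaloisGroup ℚ) W.geomPoints := by
      rw [hfp]
      exact ⟨P i, rfl⟩
    exact MulAction.mem_fixedPoints.mp hmemfix τ
  intro τ T
  obtain ⟨i, rfl⟩ := hsurj T
  apply Subtype.ext
  rw [AddSubgroup.torsionBy.coe_smul]
  exact hfix τ i

/-- **There are no nine distinct rational points killed by `3`**: `Γ_ℚ` would act trivially on `W[3]`, hence (Weil pairing,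
`exists_isPrimitiveRoot_fixed`) fix a primitive cube root of unity, which would be a rational number `q` with `q³ = 1`, `q ≠ 1`.
[cite: SilvermanAEC2009, Cor. III.8.1.1] -/
theorem false_of_nine_torsion_points (P : Fin 3 × Fin 3 → (W.baseChange ℚ).toAffine.Point)
    (hinj : Function.Injective P) (h3 : ∀ i, (3 : ℤ) • P i = 0) : False := by
  have hfix := forall_smul_eq_of_nine_torsion_points W P hinj h3
  have hT₀ : ∃ T₀ : W.geomPoints, ((3 : ℕ) : ℤ) • T₀ = 0 ∧ ∀ d : ℕ, 0 < d → d < 3 → (d : ℤ) • T₀ ≠ 0 := by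
    have h := exists_geomTorsion_exactOrder_prime W Nat.prime_three 0
    simpa only [zero_add, pow_one] using h
  obtain ⟨ζ, hζ, hζfix⟩ := exists_isPrimitiveRoot_fixed (E := W) (q := 3) (by norm_num) hT₀
  have hζrat : ∀ σ : AlgebraicClosure ℚ ≃ₐ[ℚ] AlgebraicClosure ℚ, σ ζ = ζ := fun σ ↦ hζfix σ (hfix σ)
  obtain ⟨q, hq⟩ := exists_ratCast_algebraMap_eq_of_forall_algEquiv_eq hζrat
  -- `q` is a primitive cube root of unity in `ℚ`: absurd
  have hq3 : q ^ 3 = 1 := by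
    have h := hζ.pow_eq_one
    rw [← hq, ← map_pow] at h
    exact (algebraMap ℚ (AlgebraicClosure ℚ)).injective (h.trans (map_one _).symm)
  have hq1 : q ≠ 1 := by
    intro h1
    rw [h1, map_one] at hq
    exact hζ.ne_one (by norm_num) hq.symm
  have hfac : (q - 1) * (q ^ 2 + q + 1) = 0 := by linear_combination hq3
  rcases mul_eq_zero.mp hfac with h | h
  · exact hq1 (by linarith)
  · nlinarith [sq_nonneg (2 * q + 1)]

end NinePoints

/-! ### §2  The index-`9` exclusion -/

section IndexNine

variable {W₁ : WeierstrassCurve ℚ} [W₁.IsElliptic] {N : ℕ} [NeZero N]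

/-- **An optimal `X₁(N)`-datum never has `Λ₁(f) = 3Λ₀(f)`** (modulo F★).  If it did, every third-period `z` of `Λ_{E₁} = c₁Λ₁(f)`
(`3z = c₁w₁`, `w₁ = 3w`) is `c₁w` with `w ∈ Λ₀(f)`, so `u₁(z) ∈ W₁(ℚ)` (F★ via `exists_point_eq_uniformize_of_mem_periodLattice`); the
nine third-periods `(iω₁ + jω₂)/3` give nine distinct rational points killed by `3`; §1.
[cite: ConradEdixhovenStein2003, §6.1.2 and §6.2] [cite: Stevens1989, §2] -/
theorem periodLatticeGamma1_ne_three_mul_periodLattice (hF : optimalGamma1Parametrization_cusp_rational)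
    (D₁ : Gamma1ParametrizationData W₁ N) (h₁ : D₁.IsOptimal) :
    ¬ (∀ z : ℂ, z ∈ periodLatticeGamma1 D₁.f ↔ ∃ w ∈ periodLattice D₁.f, z = 3 * w) := by
  intro hidx
  -- every third-period of `Λ_{E₁}` uniformises to a rational point
  have key : ∀ z : ℂ, 3 * z ∈ D₁.L.lattice →
      ∃ P : (W₁.baseChange ℚ).toAffine.Point, Affine.Point.baseChange (W' := W₁) ℚ ℂ P = D₁.uniformize z := by
    intro z hz
    obtain ⟨w₁, hw₁, hzw⟩ := h₁ _ hz
    obtain ⟨w, hw, rfl⟩ := (hidx w₁).mp hw₁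
    have hz' : z = (D₁.c : ℂ) * w := by
      have h : (3 : ℂ) * z = 3 * ((D₁.c : ℂ) * w) := by rw [hzw]; ring
      exact mul_left_cancel₀ (by norm_num) h
    rw [hz']
    exact exists_point_eq_uniformize_of_mem_periodLattice hF D₁ h₁ hw
  -- the nine third-periods
  set zz : Fin 3 × Fin 3 → ℂ := fun ij ↦ (((ij.1 : ℕ) : ℂ) * D₁.L.ω₁ + ((ij.2 : ℕ) : ℂ) * D₁.L.ω₂) / 3 with hzz
  have hzz3 : ∀ ij, 3 * zz ij ∈ D₁.L.lattice := by
    intro ij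
    rw [hzz]
    simp only
    rw [mul_div_cancel₀ _ (three_ne_zero' ℂ)]
    refine add_mem ?_ ?_
    · have := Submodule.smul_mem D₁.L.lattice ((ij.1 : ℕ) : ℤ) D₁.L.ω₁_mem_lattice
      simpa [zsmul_eq_mul] using this
    · have := Submodule.smul_mem D₁.L.lattice ((ij.2 : ℕ) : ℤ) D₁.L.ω₂_mem_lattice
      simpa [zsmul_eq_mul] using this
  choose P hP using fun ij ↦ key (zz ij) (hzz3 ij)
  have hbc_inj : Function.Injective (Affine.Point.baseChange (W' := W₁) ℚ ℂ) := Affine.Point.map_injective _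
  refine false_of_nine_torsion_points W₁ P ?_ ?_
  · -- distinct: `zz ij − zz kl ∈ Λ_{E₁}` forces `ij = kl`
    intro ij kl h
    have hu : D₁.uniformize (zz ij - zz kl) = 0 := by
      rw [map_sub, ← hP ij, ← hP kl, h, sub_self]
    rw [gamma1_uniformize_eq_zero_iff] at hu
    have hform : zz ij - zz kl =
        ((((ij.1 : ℕ) : ℚ) - ((kl.1 : ℕ) : ℚ)) / 3 : ℚ) * D₁.L.ω₁ + ((((ij.2 : ℕ) : ℚ) - ((kl.2 : ℕ) : ℚ)) / 3 : ℚ) * D₁.L.ω₂ := by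
      rw [hzz]; push_cast; ring
    rw [hform, PeriodPair.mul_ω₁_add_mul_ω₂_mem_lattice] at hu
    have hint : ∀ {a b : Fin 3}, ((((a : ℕ) : ℚ) - ((b : ℕ) : ℚ)) / 3 : ℚ).den = 1 → a = b := by
      intro a b hden
      have hx := (Rat.den_eq_one_iff _).mp hden
      set m := ((((a : ℕ) : ℚ) - ((b : ℕ) : ℚ)) / 3 : ℚ).num with hm
      have h' : (((a : ℕ) : ℚ) - ((b : ℕ) : ℚ)) = (m : ℚ) * 3 := by
        rw [← div_eq_iff (three_ne_zero' ℚ)]; exact hx.symm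
      have h3 : ((a : ℕ) : ℤ) - ((b : ℕ) : ℤ) = m * 3 := by exact_mod_cast h'
      have ha := a.isLt
      have hb := b.isLt
      apply Fin.ext
      omega
    exact Prod.ext (hint hu.1) (hint hu.2)
  · intro ij
    apply hbc_inj
    rw [map_zsmul, hP ij, map_zero, ← map_zsmul, zsmul_eq_mul, Int.cast_ofNat, gamma1_uniformize_eq_zero_iff]
    exact hzz3 ij

/-- **The LEAD's binder `hne9` discharged (modulo `hex` ∧ F★):** for every globally minimal elliptic `W₀` with a lattice-optimal
`X₀(N)`-datum `D₀` at `9 ∣ N`, `Λ₁(f) ≠ 3Λ₀(f)` — `hex` supplies Stevens' datum `D₁` of the class, with the same newform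
(`Gamma1ParametrizationData.f_eq_of_isIsogenous`), and `periodLatticeGamma1_ne_three_mul_periodLattice` applies.  (Neither `9 ∣ N` nor the
lattice clause is used beyond feeding `hex`.) [cite: Stevens1989, §2] [cite: ConradEdixhovenStein2003, §6.1.2 and §6.2] -/
theorem periodLatticeGamma1_ne_three_mul_of_cusp_rational (hex : exists_optimal_gamma1ParametrizationData)
    (hF : optimalGamma1Parametrization_cusp_rational) (W₀ : WeierstrassCurve ℚ) [W₀.IsElliptic] [W₀.IsGloballyMinimal]
    {N : ℕ} [NeZero N] (D₀ : ModularParametrizationData W₀ N)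
    (h₀ : ∀ z ∈ D₀.L.lattice, ∃ w ∈ periodLattice D₀.f, z = D₀.c * w) :
    ¬ (∀ z : ℂ, z ∈ periodLatticeGamma1 D₀.f ↔ ∃ w ∈ periodLattice D₀.f, z = 3 * w) := by
  obtain ⟨W₁, _, _, D₁, hiso, h₁⟩ := hex W₀ D₀ h₀
  have hf : D₁.f = D₀.f := D₁.f_eq_of_isIsogenous D₀ hiso
  rw [← hf]
  exact periodLatticeGamma1_ne_three_mul_periodLattice hF D₁ h₁

end IndexNine

end Summit.BirchSwinnertonDyer.BirchSwinnertonDyer.Theorems.ManinLocalTwoThree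

end
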